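import Summits.Ventures.LatticeQCDFlow.Scoring.OnePlaquetteEnclosures
import Summits.Ventures.LatticeQCDFlow.Scoring.OnePlaquetteBessel
import Literature.Analysis.FunctionSpaces.BesselIRecurrence
import HarnessLib

/-!
# The SU(2) one-plaquette second moment `⟨cos² α⟩_b = ¼(1 + 3 I₃(b)/I₁(b))` and its width-`10⁻²⁰` kernel enclosures at `b = 1.8, 2.2, 2.7`

HONEST FRAMING: exact (Metropolis-corrected) sampling algorithms for lattice gauge theory;
figures of merit are autocorrelation/cost numbers at stated couplings and volumes; no
continuum-physics claim.

Venture `LatticeQCDFlow` (cell pub-lqcd), sub-topic `Scoring`; FANOUT row 5 (`s0-sun-a`), GEN-12.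
NEW WORK of the cell (placement rule); the second-moment companion of GEN-5's `OnePlaquetteEnclosures`
(`⟨cos α⟩_b = I₂(b)/I₁(b)`, `su2Check`) and GEN-7's `OnePlaquetteBessel`, feeding the error-bar oracle
`Var(P̄) = v(β)/L² + O(r^{L²−2})` (`SU2TorusPlaquetteAverageVariance`, `v = ¼(1 + 3 I₃/I₁) − (I₂/I₁)²` at `b = 2β`):

* `onePlaquetteExpectSU2_cos_sq_eq` — for `b ≠ 0`, `⟨cos² α⟩_b = ¼(1 + 3 I₃(b)/I₁(b))`
  (`cos²α sin²α = (1 − cos 4α)/8`, `∫₀^π e^{b cos α} cos nα = π I_n(b)`, `b(I_n − I_{n+2}) = 2(n+1) I_{n+1}`);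
* `abs_onePlaquetteN2SU2_sub_le` — truncation: `|∫₀^π cos²α sin²α e^{b cos α} − π Σ_{k<K} b^k (r_{k+2} − r_{k+4})/k!|
  ≤ π·2b^K/K!`; `su2SqCheck_sound` — GEN-5's rational checker `ratioCheck` applied to the second-moment
  numerator certifies `lo ≤ ⟨cos² α⟩_b ≤ hi` (seven inequalities, `decide +kernel`);
* `onePlaquetteExpectSU2_cos_sq_encl20_1p8 / 2p2 / 2p7` — `0.33437936656728404568 ≤ ⟨cos²α⟩_{1.8} ≤ …569`,
  `0.36661951099488139456 ≤ ⟨cos²α⟩_{2.2} ≤ …457`, `0.40781029601146825366 ≤ ⟨cos²α⟩_{2.7} ≤ …367`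
  (`K = 28 / 30 / 32`).

Elementary; nothing is cited beyond the tree's DLMF-tagged Bessel lemmas; no `def`.
-/

namespace Summit.Ventures.LatticeQCDFlow.Scoring

open Real MeasureTheory intervalIntegral Finset Literature.Analysis.FunctionSpaces
open scoped Nat

/-! ### 1. `⟨cos² α⟩_b = ¼(1 + 3 I₃(b)/I₁(b))` -/

/-- `cos² α · sin² α = (1 − cos 4α)/8`. -/
theorem cos_sq_mul_sin_sq (α : ℝ) : Real.cos α ^ 2 * Real.sin α ^ 2 = (1 - Real.cos (4 * α)) / 8 := by
  have h4 : Real.cos (4 * α) = 2 * Real.cos (2 * α) ^ 2 - 1 := by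
    rw [show (4 : ℝ) * α = 2 * (2 * α) by ring, Real.cos_two_mul]
  rw [h4, Real.cos_two_mul, Real.sin_sq]
  ring

/-- `∫₀^π cos² α sin² α e^{b cos α} dα = (π/8)(I₀(b) − I₄(b))`. -/
theorem integral_cos_sq_sin_sq_exp (b : ℝ) :
    ∫ α in (0 : ℝ)..π, Real.cos α ^ 2 * (Real.sin α ^ 2 * Real.exp (b * Real.cos α)) =
      π / 8 * (besselI 0 b - besselI 4 b) := by
  have hpt : (fun α => Real.cos α ^ 2 * (Real.sin α ^ 2 * Real.exp (b * Real.cos α))) =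
      fun α => (1 / 8 : ℝ) * (Real.exp (b * Real.cos α) * Real.cos ((0 : ℕ) * α)) -
        (1 / 8 : ℝ) * (Real.exp (b * Real.cos α) * Real.cos ((4 : ℕ) * α)) := by
    funext α
    rw [← mul_assoc, cos_sq_mul_sin_sq]
    push_cast
    rw [zero_mul, Real.cos_zero]
    ring
  have hc : ∀ n : ℕ, Continuous fun α : ℝ => (1 / 8 : ℝ) * (Real.exp (b * Real.cos α) * Real.cos (n * α)) :=
    fun n => by fun_prop
  rw [hpt, intervalIntegral.integral_sub ((hc 0).intervalIntegrable _ _) ((hc 4).intervalIntegrable _ _),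
    intervalIntegral.integral_const_mul, intervalIntegral.integral_const_mul,
    integral_exp_mul_cos_mul_cos_nat_eq_pi_mul, integral_exp_mul_cos_mul_cos_nat_eq_pi_mul]
  ring

/-- **The SU(2) one-plaquette second moment is a Bessel ratio**: for `b ≠ 0`,
`⟨cos² α⟩_b = ¼(1 + 3 I₃(b)/I₁(b))` — the infinite-volume / one-plaquette value of `⟨(½ tr U_p)²⟩`. -/
theorem onePlaquetteExpectSU2_cos_sq_eq {b : ℝ} (hb : b ≠ 0) :
    onePlaquetteExpectSU2 b (fun α => Real.cos α ^ 2) = 1 / 4 * (1 + 3 * (besselI 3 b / besselI 1 b)) := by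
  have hZ := beta_mul_onePlaquetteZSU2 b
  have hZpos := onePlaquetteZSU2_pos b
  have h02 := mul_besselI_sub_besselI_add_two 0 b
  have h24 := mul_besselI_sub_besselI_add_two 2 b
  have hI1 : besselI 1 b ≠ 0 := by
    intro h0
    rw [h0, mul_zero] at hZ
    exact (mul_ne_zero hb hZpos.ne') hZ
  unfold onePlaquetteExpectSU2
  rw [integral_cos_sq_sin_sq_exp]
  have hZ' : onePlaquetteZSU2 b = π * besselI 1 b / b := by
    rw [eq_div_iff hb, mul_comm]; exact hZ
  rw [hZ']
  have hπ : (π : ℝ) ≠ 0 := Real.pi_ne_zero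
  -- `b (I₀ − I₄) = 2 I₁ + 6 I₃`
  have hkey : b * (besselI 0 b - besselI 4 b) = 2 * besselI 1 b + 6 * besselI 3 b := by
    push_cast at h02 h24
    linear_combination h02 + h24
  have hI0I4 : besselI 0 b - besselI 4 b = (2 * besselI 1 b + 6 * besselI 3 b) / b := by
    rw [eq_div_iff hb]
    linarith [hkey]
  rw [hI0I4]
  field_simp
  ring

/-! ### 2. The truncation bound for the second-moment numerator and the certificate checker -/

/-- SU(2) second-moment numerator:
`|∫₀^π cos² α sin² α e^{β cos α} − π Σ_{k<K} β^k (r_{k+2} − r_{k+4})/k!| ≤ π · 2β^K/K!`. -/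
theorem abs_onePlaquetteN2SU2_sub_le {β : ℝ} (hβ : 0 ≤ β) {K : ℕ} (hK : 2 * β ≤ K + 1) :
    |(∫ α in (0 : ℝ)..π, Real.cos α ^ 2 * (Real.sin α ^ 2 * Real.exp (β * Real.cos α)))
      - π * ∑ k ∈ range K, β ^ k / (k ! : ℝ) * ((cosMom (k + 2) - cosMom (k + 4) : ℚ) : ℝ)|
      ≤ π * (2 * β ^ K / (K ! : ℝ)) := by
  have hm : ∀ k : ℕ, ∫ α in (0 : ℝ)..π, (Real.cos α ^ 2 * Real.sin α ^ 2) * Real.cos α ^ k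
      = π * ((cosMom (k + 2) - cosMom (k + 4) : ℚ) : ℝ) := by
    intro k
    have hpt : (fun α => (Real.cos α ^ 2 * Real.sin α ^ 2) * Real.cos α ^ k)
        = fun α => Real.cos α ^ (k + 2) - Real.cos α ^ (k + 4) := by
      funext α; rw [Real.sin_sq]; ring
    rw [hpt, intervalIntegral.integral_sub ((by fun_prop : Continuous fun α => Real.cos α ^ (k + 2)).intervalIntegrable _ _)
      ((by fun_prop : Continuous fun α => Real.cos α ^ (k + 4)).intervalIntegrable _ _),
      integral_cos_pow_eq_mul_cosMom Real.sin_pi (k + 2),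
      integral_cos_pow_eq_mul_cosMom Real.sin_pi (k + 4)]
    push_cast
    ring
  have h1 : ∀ α, |Real.cos α ^ 2 * Real.sin α ^ 2| ≤ 1 := fun α => by
    rw [abs_mul, abs_of_nonneg (sq_nonneg (Real.sin α)), abs_of_nonneg (sq_nonneg (Real.cos α))]
    calc Real.cos α ^ 2 * Real.sin α ^ 2 ≤ 1 * 1 := by
          gcongr
          · exact Real.cos_sq_le_one α
          · exact Real.sin_sq_le_one α
      _ = 1 := one_mul _
  have h := abs_integral_weight_exp_sub_le (w := fun α => Real.cos α ^ 2 * Real.sin α ^ 2) (by fun_prop) h1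
    Real.pi_pos.le hm hβ hK
  have hpt2 : (fun α => Real.cos α ^ 2 * (Real.sin α ^ 2 * Real.exp (β * Real.cos α)))
      = fun α => (Real.cos α ^ 2 * Real.sin α ^ 2) * Real.exp (β * Real.cos α) := by
    funext α; ring
  rw [hpt2]
  exact h

/-- **Soundness of the second-moment certificate** (no new `def`: the checker is GEN-5's `ratioCheck`
applied to the truncated numerator `n_K = Σ_{k<K} β^k (r_{k+2} − r_{k+4})/k!` (`psumQ`) and `su2Zsum`):
`ratioCheck β n_K z_K lo hi K = true` implies `lo ≤ onePlaquetteExpectSU2 β cos² ≤ hi`. -/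
theorem su2SqCheck_sound {β lo hi : ℚ} {K : ℕ}
    (h : ratioCheck β (psumQ (fun k => β ^ k / k ! * (cosMom (k + 2) - cosMom (k + 4))) K)
      (su2Zsum β K) lo hi K = true) :
    ((lo : ℚ) : ℝ) ≤ onePlaquetteExpectSU2 ((β : ℚ) : ℝ) (fun α => Real.cos α ^ 2) ∧
      onePlaquetteExpectSU2 ((β : ℚ) : ℝ) (fun α => Real.cos α ^ 2) ≤ ((hi : ℚ) : ℝ) := by
  obtain ⟨hβ, hK, hlo0, htz, htn, hlo, hhi⟩ := ratioCheck_spec h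
  have hβ' : (0 : ℝ) ≤ ((β : ℚ) : ℝ) := by exact_mod_cast hβ
  have hK' : 2 * ((β : ℚ) : ℝ) ≤ (K : ℝ) + 1 := by exact_mod_cast hK
  have hZ := abs_onePlaquetteZSU2_sub_le hβ' hK'
  have hN := abs_onePlaquetteN2SU2_sub_le hβ' hK'
  have ez : ((su2Zsum β K : ℚ) : ℝ)
      = ∑ k ∈ range K, ((β : ℚ) : ℝ) ^ k / (k ! : ℝ) * ((cosMom k - cosMom (k + 2) : ℚ) : ℝ) := by
    rw [su2Zsum, psumQ_eq_sum]; push_cast; rfl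
  have en : ((psumQ (fun k => β ^ k / k ! * (cosMom (k + 2) - cosMom (k + 4))) K : ℚ) : ℝ)
      = ∑ k ∈ range K, ((β : ℚ) : ℝ) ^ k / (k ! : ℝ) * ((cosMom (k + 2) - cosMom (k + 4) : ℚ) : ℝ) := by
    rw [psumQ_eq_sum]; push_cast; rfl
  have et : ((expTail β K : ℚ) : ℝ) = 2 * ((β : ℚ) : ℝ) ^ K / (K ! : ℝ) := by
    rw [expTail]; push_cast; rfl
  rw [← ez] at hZ
  rw [← en] at hN
  rw [← et] at hZ hN
  unfold onePlaquetteExpectSU2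
  exact div_mem_of_abs_sub_le Real.pi_pos hN hZ (by exact_mod_cast hlo0) (by exact_mod_cast htz)
    (by exact_mod_cast htn) (by exact_mod_cast hlo) (by exact_mod_cast hhi)

/-! ### 3. The three enclosures (width `10⁻²⁰`) -/

/-- `0.33437936656728404568 ≤ ⟨cos² α⟩_{1.8} = ¼(1 + 3 I₃(1.8)/I₁(1.8)) ≤ 0.33437936656728404569` (`K = 28`). -/
theorem onePlaquetteExpectSU2_cos_sq_encl20_1p8 :
    (33437936656728404568 : ℝ) / 100000000000000000000 ≤ onePlaquetteExpectSU2 (9 / 5) (fun α => Real.cos α ^ 2) ∧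
      onePlaquetteExpectSU2 (9 / 5) (fun α => Real.cos α ^ 2) ≤ (33437936656728404569 : ℝ) / 100000000000000000000 := by
  have h := su2SqCheck_sound (β := 9 / 5) (lo := 33437936656728404568 / 100000000000000000000)
    (hi := 33437936656728404569 / 100000000000000000000) (K := 28) (by decide +kernel)
  push_cast at h
  exact h

/-- `0.36661951099488139456 ≤ ⟨cos² α⟩_{2.2} ≤ 0.36661951099488139457` (`K = 30`). -/
theorem onePlaquetteExpectSU2_cos_sq_encl20_2p2 :
    (36661951099488139456 : ℝ) / 100000000000000000000 ≤ onePlaquetteExpectSU2 (11 / 5) (fun α => Real.cos α ^ 2) ∧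
      onePlaquetteExpectSU2 (11 / 5) (fun α => Real.cos α ^ 2) ≤ (36661951099488139457 : ℝ) / 100000000000000000000 := by
  have h := su2SqCheck_sound (β := 11 / 5) (lo := 36661951099488139456 / 100000000000000000000)
    (hi := 36661951099488139457 / 100000000000000000000) (K := 30) (by decide +kernel)
  push_cast at h
  exact h

/-- `0.40781029601146825366 ≤ ⟨cos² α⟩_{2.7} ≤ 0.40781029601146825367` (`K = 32`). -/
theorem onePlaquetteExpectSU2_cos_sq_encl20_2p7 :
    (40781029601146825366 : ℝ) / 100000000000000000000 ≤ onePlaquetteExpectSU2 (27 / 10) (fun α => Real.cos α ^ 2) ∧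
      onePlaquetteExpectSU2 (27 / 10) (fun α => Real.cos α ^ 2) ≤ (40781029601146825367 : ℝ) / 100000000000000000000 := by
  have h := su2SqCheck_sound (β := 27 / 10) (lo := 40781029601146825366 / 100000000000000000000)
    (hi := 40781029601146825367 / 100000000000000000000) (K := 32) (by decide +kernel)
  push_cast at h
  exact h

end Summit.Ventures.LatticeQCDFlow.Scoring
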